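import Literature.Probability.RandomPlanarGeometry.HexSAWSurfaceWallRenewal

/-!
# The six-step law for irreducible positive wall bridges of the adsorbing honeycomb walk

For the self-avoiding walk on the honeycomb lattice (brick-wall frame) in the half-plane `Y ≤ 0`, an
IRREDUCIBLE POSITIVE WALL BRIDGE of length `n ≥ 4` (`ipwb n` of `HexSAWSurfaceWallRenewal`: a positive wall
bridge with no wall-renewal time in `[1, n)`) makes at most `n / 6` surface visits:

* `six_mul_visits_le : ω ∈ ipwb n → 4 ≤ n → 6 * visits n ω ≤ n` — sharp at every `n = 6k` (the hook
  staircases), improving the tree's entropy lemma `four_mul_visits_le : 4 * visits n ω ≤ n + 2`;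
* `three_mul_visits_le : ω ∈ ipwb (2 * s) → 2 ≤ s → 3 * visits (2 * s) ω ≤ s` — the class `(s, v)` of the
  irreducible census is EMPTY whenever `3 v > s`, so the diagonal `s − v = k` of Kesten's identity
  `∑ₛ fₛ = 1` is supported on `s ≤ 3k/2` (finitely many classes per order of the `1/y` expansion of `β(y)²`);
* §5 the ENVELOPE it yields: `IPWB_le_pow_mul_pow_div_three : IPWB (2s) y ≤ μ^{2s+2} · y^{⌊s/3⌋}` and
  `pwbLaw_le_pow_div_pow_sub : pwbLaw y s ≤ μ^{2s+2} / y^{s − ⌊s/3⌋}` (`y ≥ 1`, `s ≥ 2`; `μ` = `hexConnectiveConstant`,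
  count `card_wbr_le_pow`) — each diagonal term of Kesten's identity is `O(y^{−2s/3})`, a geometric tail of ratio `μ² y^{−2/3}`.

Proof (three charging lemmas and the step bookkeeping `n = X_n + 2·#left + 2·#down` of `steps_count`):
(L) `exists_left_step_onto_pred` — besides the left step landing on its own column `X_t` (the tree's
`exists_left_step_onto`), every interior visit time `t` owns a left step landing on the odd column `X_t − 1`,
unless `t` is a NEAR-RENEWAL (`NearRenewal`: the walk leaves `(X_t, 0)` to the right, its head stays in
`X ≤ X_t − 1` and its tail in `X ≥ X_t`); (D) `one_le_card_stepsD`, `two_mul_card_nearRenewal_le_card_stepsD` —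
there is a down step, and every near-renewal owns two down steps inside its own time window (the forced return to
column `X_t` is entered from the right and left vertically, so the walk reaches depth `−2`:
`exists_deep_return_of_nearRenewal`); (G) `exists_gap` — some even abscissa in `[2, X_n − 2]` is never visited.
NEW (the lane's «six steps per visit» conjecture, FINDING-HEX-WALL-RENEWAL-CENSUS §3, verified by enumeration to
`n = 40`); the model is Madras–Slade's remark that an irreducible bridge of span `L` has at least `3L` steps.
-/

noncomputable section

open Finset Filter Function
open Literature.Probability.LatticeModels Literature.Probability.Percolation SimpleGraph

namespace Literature.Probability.RandomPlanarGeometry.SAW.HexBW.Wall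

variable {n : ℕ} {ω : ℕ → Site 2}

/-- A NEAR-RENEWAL visit time: the walk leaves `(X_t, 0)` to the right, its head stays in `X ≤ X_t − 1`
and its tail in `X ≥ X_t` (so only a return to column `X_t` at depth prevents a wall-renewal time). NEW notion.
[cite: MadrasSlade1993, §4.2, Definition 4.2.1 (renewal / break points of a bridge)] -/
def NearRenewal (n : ℕ) (ω : ℕ → Site 2) (t : ℕ) : Prop :=
  ω (t + 1) 0 = ω t 0 + 1 ∧ (∀ i, i < t → ω i 0 ≤ ω t 0 - 1) ∧ (∀ j, t < j → j ≤ n → ω t 0 ≤ ω j 0)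

/-- [folklore] Two coordinates determine a site of `ℤ²`. -/
private theorem site_ext_six {p q : Site 2} (h0 : p 0 = q 0) (h1 : p 1 = q 1) : p = q := by
  funext k
  fin_cases k
  · exact h0
  · exact h1

/-- On a positive wall bridge in the half-plane, the two steps around a visit time `t ∈ [1, n)` are HORIZONTAL
along the wall: `Y_{t-1} = Y_{t+1} = 0`, `X_{t±1} = X_t ± 1` (the vertical bond at an even wall site points out
of the half-plane). [cite: EntingJensen2009, §7.4.2, Fig. 7.10 (brickwork form of the honeycomb lattice)] -/
theorem wall_steps_horizontal (hp : ω ∈ pwb n) {t : ℕ} (ht1 : 1 ≤ t) (htn : t < n) (ht2 : t % 2 = 0)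
    (hY : ω t 1 = 0) :
    ((ω (t + 1) 0 = ω t 0 + 1 ∨ ω (t + 1) 0 = ω t 0 - 1) ∧ ω (t + 1) 1 = 0) ∧
      ((ω (t - 1) 0 = ω t 0 + 1 ∨ ω (t - 1) 0 = ω t 0 - 1) ∧ ω (t - 1) 1 = 0) ∧
      ω (t - 1) 0 ≠ ω (t + 1) 0 := by
  obtain ⟨hw, -⟩ := mem_pwb.1 hp
  obtain ⟨ha, -⟩ := mem_wbr.1 hw
  obtain ⟨hh, -, -⟩ := mem_archs.1 ha
  obtain ⟨hs, hhp⟩ := mem_hpw.1 hh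
  obtain ⟨-, -, hbw, hinj⟩ := mem_saws_iff.1 hs
  have hpar := parity_apply hs htn.le
  rw [hY, add_zero] at hpar
  have hpar' : ω t 0 % 2 = 0 := by omega
  have hY1 : ω (t + 1) 1 ≤ 0 := hhp (t + 1) (by omega)
  have hY0 : ω (t - 1) 1 ≤ 0 := hhp (t - 1) (by omega)
  have hadj1 := (brickWallGraph_adj_coord _ _).1 (hbw t htn)
  have hadj0 := (brickWallGraph_adj_coord _ _).1 (hbw (t - 1) (by omega))
  rw [show t - 1 + 1 = t by omega] at hadj0
  have h1 : (ω (t + 1) 0 = ω t 0 + 1 ∨ ω (t + 1) 0 = ω t 0 - 1) ∧ ω (t + 1) 1 = 0 := by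
    rcases hadj1 with ⟨h01, h11⟩ | ⟨h00, ⟨h1a, -⟩ | ⟨h1a, h1b⟩⟩
    · exact ⟨by omega, by rw [h11, hY]⟩
    · exfalso; rw [hY] at h1a; omega
    · exfalso; rw [hY] at h1a; rw [h00] at h1b; omega
  have h0 : (ω (t - 1) 0 = ω t 0 + 1 ∨ ω (t - 1) 0 = ω t 0 - 1) ∧ ω (t - 1) 1 = 0 := by
    rcases hadj0 with ⟨h01, h11⟩ | ⟨h00, ⟨h1a, h1b⟩ | ⟨h1a, -⟩⟩
    · exact ⟨by omega, by rw [← h11, hY]⟩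
    · exfalso; rw [hY] at h1a; rw [← h00] at h1b; omega
    · exfalso; rw [hY] at h1a; omega
  refine ⟨h1, h0, fun he => ?_⟩
  have : t - 1 = t + 1 :=
    hinj (show t - 1 ∈ {i | i ≤ n} by simp; omega) (show t + 1 ∈ {i | i ≤ n} by simp; omega)
      (site_ext_six he (by rw [h0.2, h1.2]))
  omega

/-- **Lemma L**: every interior visit time `t` owns a left step landing on the odd column `X_t − 1` — the wall
step at `t` itself, or a descent supplied by an overhang `X_i ≥ X_t` before `t` or a return `X_j ≤ X_t − 1` after
`t` — unless `t` is a near-renewal. NEW. [cite: MadrasSlade1993, §4.2, Definition 4.2.1] -/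
theorem exists_left_step_onto_pred (hω : ω ∈ ipwb n) {t : ℕ} (ht1 : 1 ≤ t) (htn : t < n)
    (ht2 : t % 2 = 0) (hY : ω t 1 = 0) :
    (∃ i, i < n ∧ ω (i + 1) 0 = ω i 0 - 1 ∧ ω (i + 1) 0 = ω t 0 - 1) ∨ NearRenewal n ω t := by
  obtain ⟨hp, -, -⟩ := mem_ipwb.1 hω
  obtain ⟨-, -, hbw, -⟩ := mem_saws_iff.1 (saws_of_mem_pwb hp)
  obtain ⟨⟨h1 | h1, -⟩, ⟨h0, -⟩, hne⟩ := wall_steps_horizontal hp ht1 htn ht2 hY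
  · -- right step at `t`; then `X_{t-1} = X_t - 1`
    have h0' : ω (t - 1) 0 = ω t 0 - 1 := by omega
    by_cases ha : ∃ i, i < t ∧ ω t 0 ≤ ω i 0
    · obtain ⟨i, hit, hi⟩ := ha
      have hit' : i < t - 1 := by
        rcases Nat.lt_or_ge i (t - 1) with h | h
        · exact h
        · have : i = t - 1 := by omega
          subst this; omega
      obtain ⟨k, -, hk2, hk3, hk4⟩ := exists_descent hbw (a := i) (b := t - 1) (c := ω t 0 - 1) hit' (by omega)
        (by omega) h0'.le
      exact Or.inl ⟨k, by omega, by omega, hk4⟩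
    · by_cases hb' : ∃ j, t < j ∧ j ≤ n ∧ ω j 0 ≤ ω t 0 - 1
      · obtain ⟨j, htj, hjn, hj⟩ := hb'
        have htj' : t + 1 < j := by
          rcases Nat.lt_or_ge (t + 1) j with h | h
          · exact h
          · have : j = t + 1 := by omega
            subst this; omega
        obtain ⟨k, -, hk2, hk3, hk4⟩ := exists_descent hbw (a := t + 1) (b := j) (c := ω t 0 - 1) htj' hjn
          (by omega) hj
        exact Or.inl ⟨k, by omega, by omega, hk4⟩
      · push Not at ha hb'
        exact Or.inr ⟨h1, fun i hi => by have := ha i hi; omega, fun j hj hjn => by have := hb' j hj hjn; omega⟩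
  · -- left step at `t`: the step itself
    exact Or.inl ⟨t, htn, h1, h1⟩

/-- Lemma D (first half): an irreducible positive wall bridge of length `n ≥ 4` has a down step (a walk with no
vertical step is the wall run `X_i = i`, for which `t = 2` is a wall-renewal time).
[cite: MadrasSlade1993, §4.2, Definition 4.2.1] -/
theorem one_le_card_stepsD (hω : ω ∈ ipwb n) (hn : 4 ≤ n) : 1 ≤ #(stepsD n ω) := by
  classical
  obtain ⟨hp, hn1, hirr⟩ := mem_ipwb.1 hω
  obtain ⟨hw, hb⟩ := mem_pwb.1 hp
  obtain ⟨ha, -⟩ := mem_wbr.1 hw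
  obtain ⟨hh, hn2, hYn⟩ := mem_archs.1 ha
  obtain ⟨hs, hhp⟩ := mem_hpw.1 hh
  obtain ⟨h0, -, hbw, hinj⟩ := mem_saws_iff.1 hs
  have hX0 : ω 0 0 = 0 := by rw [h0]; rfl
  have hY0 : ω 0 1 = 0 := by rw [h0]; rfl
  by_contra hD
  have hD0 : #(stepsD n ω) = 0 := by omega
  obtain ⟨-, -, hY⟩ := steps_count hbw
  rw [hY0, hYn, sub_zero, hD0] at hY
  have hU0 : #(stepsU n ω) = 0 := by exact_mod_cast (by push_cast at hY ⊢; linarith : (#(stepsU n ω) : ℤ) = 0)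
  have hUe : stepsU n ω = ∅ := Finset.card_eq_zero.1 hU0
  have hDe : stepsD n ω = ∅ := Finset.card_eq_zero.1 hD0
  -- every step is horizontal
  have hhor : ∀ i, i < n → (ω (i + 1) 0 = ω i 0 + 1 ∨ ω (i + 1) 0 = ω i 0 - 1) ∧ ω (i + 1) 1 = ω i 1 := by
    intro i hi
    rcases step_cases hbw hi with h | h | h | h
    · exact ⟨Or.inl h.1, h.2⟩
    · exact ⟨Or.inr h.1, h.2⟩
    · exfalso
      have : i ∈ stepsU n ω := by rw [stepsU, Finset.mem_filter, Finset.mem_range]; exact ⟨hi, h⟩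
      rw [hUe] at this; simp at this
    · exfalso
      have : i ∈ stepsD n ω := by rw [stepsD, Finset.mem_filter, Finset.mem_range]; exact ⟨hi, h⟩
      rw [hDe] at this; simp at this
  have hYall : ∀ i, i ≤ n → ω i 1 = 0 := by
    intro i hi
    induction i with
    | zero => exact hY0
    | succ i ih => rw [(hhor i (by omega)).2, ih (by omega)]
  -- the walk is the wall run `X_i = i`
  have hXall : ∀ i, i ≤ n → ω i 0 = i := by
    intro i
    induction i using Nat.strong_induction_on with
    | _ i ih =>
      intro hi
      rcases i with _ | i
      · exact_mod_cast hX0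
      · rcases (hhor i (by omega)).1 with h | h
        · rw [h, ih i (by omega) (by omega)]; push_cast; ring
        · exfalso
          rcases i with _ | i
          · have := (hb 1 le_rfl (by omega)).1
            rw [hX0] at this; simp only [zero_add] at h; rw [h, hX0] at this; norm_num at this
          · -- `ω (i+2) = ω i`: contradiction with injectivity
            have h2 : ω (i + 1 + 1) 0 = ω i 0 := by
              rw [h, ih (i + 1) (by omega) (by omega), ih i (by omega) (by omega)]; push_cast; ring
            have h3 : ω (i + 1 + 1) 1 = ω i 1 := by
              rw [hYall (i + 1 + 1) hi, hYall i (by omega)]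
            have := hinj (show i + 1 + 1 ∈ {k | k ≤ n} from hi) (show i ∈ {k | k ≤ n} by simp; omega)
              (site_ext_six h2 h3)
            omega
  -- so `t = 2` is a wall-renewal time
  refine hirr 2 (by omega) (by omega) ⟨⟨by omega, fun i hi1 hi2 => ?_, fun i hi1 hi2 => ?_⟩, rfl, hYall 2 (by omega)⟩
  · rw [hXall 0 (by omega), hXall i (by omega), hXall 2 (by omega)]; constructor <;> omega
  · show ω (2 + 0) 0 < ω (2 + i) 0 ∧ ω (2 + i) 0 ≤ ω (2 + (n - 2)) 0
    rw [hXall (2 + 0) (by omega), hXall (2 + i) (by omega), hXall (2 + (n - 2)) (by omega)]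
    constructor <;> push_cast <;> omega

/-- **Vertical discrete descent**: if `Y_a > c ≥ Y_b` with `a < b ≤ n`, some step `i ∈ [a, b)` is a down step
from row `c + 1` onto row `c`. [cite: MadrasSlade1993, §1.2] -/
theorem exists_descentY (hbw : IsBW n ω) {a b : ℕ} {c : ℤ} (hab : a < b) (hbn : b ≤ n) (ha : c < ω a 1)
    (hb : ω b 1 ≤ c) : ∃ i, a ≤ i ∧ i < b ∧ ω i 1 = c + 1 ∧ ω (i + 1) 1 = c := by
  classical
  have hex : ∃ s, a < s ∧ s ≤ b ∧ ω s 1 ≤ c := ⟨b, hab, le_rfl, hb⟩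
  obtain ⟨hs1, hs2, hs3⟩ := Nat.find_spec hex
  set s := Nat.find hex with hs
  have hi : c < ω (s - 1) 1 := by
    rcases eq_or_lt_of_le (show a ≤ s - 1 by omega) with h | h
    · rw [← h]; exact ha
    · have := Nat.find_min hex (show s - 1 < s by omega)
      rw [not_and, not_and, not_le] at this
      exact this h (by omega)
  have hstep : ω (s - 1 + 1) 1 - ω (s - 1) 1 ≤ 1 ∧ -1 ≤ ω (s - 1 + 1) 1 - ω (s - 1) 1 := by
    have h := (brickWallGraph_adj_coord _ _).1 (hbw (s - 1) (by omega))
    constructor <;> omega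
  rw [show s - 1 + 1 = s by omega] at hstep
  exact ⟨s - 1, by omega, by omega, by omega, by rw [show s - 1 + 1 = s by omega]; omega⟩

/-- After a near-renewal visit time `t`, the walk reaches depth `Y ≤ −2` at some time `s > t` with `X_s = X_t`
(the forced return to column `X_t` is entered from the right and can only be left vertically).
[cite: MadrasSlade1993, §4.2, Definition 4.2.1] -/
theorem exists_deep_return_of_nearRenewal (hω : ω ∈ ipwb n) {t : ℕ} (ht1 : 1 ≤ t) (htn : t < n)
    (ht2 : t % 2 = 0) (hY : ω t 1 = 0) (hnr : NearRenewal n ω t) :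
    ∃ s, t < s ∧ s ≤ n ∧ ω s 0 = ω t 0 ∧ ω s 1 ≤ -2 := by
  classical
  obtain ⟨hp, hn1, hirr⟩ := mem_ipwb.1 hω
  obtain ⟨hw, hb⟩ := mem_pwb.1 hp
  obtain ⟨ha, -⟩ := mem_wbr.1 hw
  obtain ⟨hh, hn2, hYn⟩ := mem_archs.1 ha
  obtain ⟨hs, hhp⟩ := mem_hpw.1 hh
  obtain ⟨h0, hend, hbw, hinj⟩ := mem_saws_iff.1 hs
  have hX0 : ω 0 0 = 0 := by rw [h0]; rfl
  have hinj' : ∀ {i j}, i ≤ n → j ≤ n → ω i 0 = ω j 0 → ω i 1 = ω j 1 → i = j := fun {i j} hi hj h0' h1' =>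
    hinj (show i ∈ {k | k ≤ n} from hi) (show j ∈ {k | k ≤ n} from hj) (site_ext_six h0' h1')
  obtain ⟨hR, hhead, htail⟩ := hnr
  -- the head `ω[0, t]` is a bridge, so the tail is not: a return to column `X_t`
  have hnren : ¬ Zd.IsRenewalTime n ω t := fun h => hirr t ht1 htn ⟨h, ht2, hY⟩
  have hbt : Zd.IsBridge t ω := fun i hi1 hi2 => by
    refine ⟨(hb i hi1 (by omega)).1, ?_⟩
    rcases lt_or_eq_of_le hi2 with h | h
    · have := hhead i h; omega
    · rw [h]
  have hex : ∃ j, 2 ≤ j ∧ t + j ≤ n ∧ ω (t + j) 0 = ω t 0 := by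
    unfold Zd.IsRenewalTime at hnren
    rw [not_and, not_and] at hnren
    have hnt := hnren htn.le hbt
    unfold Zd.IsBridge at hnt
    push Not at hnt
    obtain ⟨j, hj1, hj2, hj⟩ := hnt
    have hle : ω (t + j) 0 ≤ ω t 0 := by
      by_contra hlt
      rw [not_le] at hlt
      have := hj hlt
      rw [show t + (n - t) = n by omega] at this
      exact absurd (hb (t + j) (by omega) (by omega)).2 (not_le.2 this)
    have hge := htail (t + j) (by omega) (by omega)
    have hj2' : 2 ≤ j := by
      by_contra h; have : j = 1 := by omega
      subst this; omega
    exact ⟨j, hj2', by omega, le_antisymm hle hge⟩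
  -- first return `p = t + j`
  obtain ⟨hj2, hjn, hjx⟩ := Nat.find_spec hex
  have hjmin : ∀ j', j' < Nat.find hex → 2 ≤ j' → t + j' ≤ n → ω (t + j') 0 ≠ ω t 0 := fun j' hj' h2 h3 he =>
    Nat.find_min hex hj' ⟨h2, h3, he⟩
  set j := Nat.find hex with hjdef
  -- the step into `p` comes from column `X_t + 1`
  have hprev : ω (t + j - 1) 0 = ω t 0 + 1 := by
    rcases lt_or_eq_of_le hj2 with h | h
    · have hne := hjmin (j - 1) (by omega) (by omega) (by omega)
      rw [show t + (j - 1) = t + j - 1 by omega] at hne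
      have hge := htail (t + j - 1) (by omega) (by omega)
      have hstep := abs_sub_apply_zero_le_one (hbw (t + j - 1) (by omega))
      rw [show t + j - 1 + 1 = t + j by omega, abs_le] at hstep
      omega
    · rw [show t + j - 1 = t + 1 by omega, hR]
  have hadj := (brickWallGraph_adj_coord _ _).1 (hbw (t + j - 1) (by omega))
  rw [show t + j - 1 + 1 = t + j by omega] at hadj
  have hYp : ω (t + j) 1 = ω (t + j - 1) 1 := by
    rcases hadj with ⟨-, h11⟩ | ⟨h00, -⟩
    · exact h11
    · omega
  have hYp1 : ω (t + j) 1 ≤ -1 := by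
    have hle := hhp (t + j) hjn
    rcases lt_or_eq_of_le hle with h | h
    · omega
    · have := hinj' hjn htn.le hjx (by rw [h, hY]); omega
  have hpn : t + j < n := by
    rcases lt_or_eq_of_le hjn with h | h
    · exact h
    · exfalso; rw [h, hYn] at hYp1; norm_num at hYp1
  -- the step out of `p` is vertical
  have hadj2 := (brickWallGraph_adj_coord _ _).1 (hbw (t + j) hpn)
  rcases hadj2 with ⟨h01 | h01, h11⟩ | ⟨h00, ⟨h1a, -⟩ | ⟨h1a, -⟩⟩
  · -- right step back to `(X_t + 1, Y_p) = ω (p - 1)`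
    exfalso
    have := hinj' (i := t + j + 1) (j := t + j - 1) (by omega) (by omega) (by rw [h01, hprev, hjx])
      (by rw [h11, hYp])
    omega
  · -- left step to column `X_t - 1`: forbidden by the tail condition
    exfalso; have := htail (t + j + 1) (by omega) (by omega); omega
  · -- up step: to `(X_t, Y_p + 1)`; if that is row `0` it is `ω t`
    rcases lt_or_eq_of_le (show ω (t + j + 1) 1 ≤ 0 from hhp _ (by omega)) with h | h
    · exact ⟨t + j, by omega, hjn, hjx, by omega⟩
    · exfalso
      have := hinj' (i := t + j + 1) (j := t) (by omega) htn.le (by rw [h00, hjx]) (by rw [h, hY])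
      omega
  · -- down step
    exact ⟨t + j + 1, by omega, by omega, by rw [h00, hjx], by omega⟩

/-- Lemma D (second half): every near-renewal visit forces two down steps of its own (from row `0` and from row
`−1`, inside its own time window). [cite: MadrasSlade1993, §4.2, Definition 4.2.1] -/
theorem two_mul_card_nearRenewal_le_card_stepsD (hω : ω ∈ ipwb n) {T : Finset ℕ}
    (hT : ∀ t ∈ T, t ∈ wallTimes n ω ∧ t < n ∧ NearRenewal n ω t) : 2 * #T ≤ #(stepsD n ω) := by
  classical
  obtain ⟨hp, hn1, hirr⟩ := mem_ipwb.1 hω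
  obtain ⟨-, -, hbw, -⟩ := mem_saws_iff.1 (saws_of_mem_pwb hp)
  have hmemW : ∀ {t}, t ∈ wallTimes n ω ↔ (1 ≤ t ∧ t ≤ n) ∧ t % 2 = 0 ∧ ω t 1 = 0 := fun {t} => by
    rw [wallTimes, Finset.mem_filter, Finset.mem_Icc]
  -- for each `t ∈ T`: a deep time `σ t`, before every later element of `T`
  have hex : ∀ t ∈ T, ∃ s, t < s ∧ s ≤ n ∧ ω s 0 = ω t 0 ∧ ω s 1 ≤ -2 := fun t ht => by
    obtain ⟨htW, htn, hnr⟩ := hT t ht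
    obtain ⟨⟨ht1, -⟩, ht2, hy⟩ := hmemW.1 htW
    exact exists_deep_return_of_nearRenewal hω ht1 htn ht2 hy hnr
  let σ : ℕ → ℕ := fun t => if h : t ∈ T then Classical.choose (hex t h) else 0
  have hσ : ∀ t (h : t ∈ T), t < σ t ∧ σ t ≤ n ∧ ω (σ t) 0 = ω t 0 ∧ ω (σ t) 1 ≤ -2 := fun t h => by
    simp only [σ, dif_pos h]; exact Classical.choose_spec (hex t h)
  have hwin : ∀ t ∈ T, ∀ t' ∈ T, t < t' → σ t < t' := fun t ht t' ht' htt' => by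
    obtain ⟨h1, h2, h3, h4⟩ := hσ t ht
    obtain ⟨-, -, ⟨-, hhead', htail'⟩⟩ := hT t' ht'
    obtain ⟨⟨-, ht'n⟩, -, hy'⟩ := hmemW.1 (hT t' ht').1
    by_contra hle
    rw [not_lt] at hle
    rcases lt_or_eq_of_le hle with h | h
    · have := htail' (σ t) h h2; have := hhead' t htt'; omega
    · rw [← h, hy'] at h4; norm_num at h4
  -- the two down steps of `t`: from row `0` and from row `-1`, with times in `[t, σ t)`
  have hd : ∀ t ∈ T, ∀ c : ℤ, c = -1 ∨ c = -2 →
      ∃ i, t ≤ i ∧ i < σ t ∧ i ∈ stepsD n ω ∧ ω i 1 = c + 1 := fun t ht c hc => by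
    obtain ⟨h1, h2, h3, h4⟩ := hσ t ht
    obtain ⟨⟨-, -⟩, -, hy⟩ := hmemW.1 (hT t ht).1
    obtain ⟨i, hi1, hi2, hi3, hi4⟩ := exists_descentY hbw (a := t) (b := σ t) (c := c) h1 h2 (by rw [hy]; omega)
      (by omega)
    refine ⟨i, hi1, hi2, ?_, hi3⟩
    rw [stepsD, Finset.mem_filter, Finset.mem_range]
    refine ⟨by omega, ?_, by omega⟩
    rcases step_cases hbw (show i < n by omega) with h | h | h | h
    · omega
    · omega
    · omega
    · exact h.1
  have hinjT : ∀ c : ℤ, (c = -1 ∨ c = -2) → #T ≤ #((stepsD n ω).filter fun i => ω i 1 = c + 1) := fun c hc => by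
    have hex' : ∀ t ∈ T, ∃ i, t ≤ i ∧ i < σ t ∧ i ∈ stepsD n ω ∧ ω i 1 = c + 1 := fun t ht => hd t ht c hc
    let φ : ℕ → ℕ := fun t => if h : t ∈ T then Classical.choose (hex' t h) else 0
    have hφ : ∀ t (h : t ∈ T), t ≤ φ t ∧ φ t < σ t ∧ φ t ∈ stepsD n ω ∧ ω (φ t) 1 = c + 1 := fun t h => by
      simp only [φ, dif_pos h]; exact Classical.choose_spec (hex' t h)
    refine Finset.card_le_card_of_injOn φ (fun t ht => ?_) (fun t ht t' ht' he => ?_)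
    · obtain ⟨-, -, h3, h4⟩ := hφ t (Finset.mem_coe.1 ht)
      rw [Finset.mem_coe, Finset.mem_filter]
      exact ⟨h3, h4⟩
    · have h1 := Finset.mem_coe.1 ht
      have h2 := Finset.mem_coe.1 ht'
      obtain ⟨a1, a2, -, -⟩ := hφ t h1
      obtain ⟨b1, b2, -, -⟩ := hφ t' h2
      by_contra hne
      rcases lt_or_gt_of_ne hne with h | h
      · have := hwin t h1 t' h2 h; omega
      · have := hwin t' h2 t h1 h; omega
  have h0 := hinjT (-1) (Or.inl rfl)
  have h1 := hinjT (-2) (Or.inr rfl)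
  norm_num at h0 h1
  have hdisj : Disjoint ((stepsD n ω).filter fun i => ω i 1 = 0) ((stepsD n ω).filter fun i => ω i 1 = -1) := by
    rw [Finset.disjoint_filter]; intro i _ h; omega
  have hcard := Finset.card_le_card (Finset.union_subset
    (Finset.filter_subset (fun i => ω i 1 = 0) (stepsD n ω)) (Finset.filter_subset (fun i => ω i 1 = -1) (stepsD n ω)))
  rw [Finset.card_union_of_disjoint hdisj] at hcard
  omega

/-- The step INTO a visit `(X_t, 0)` (`t ∈ [1, n]` even, `Y_t = 0`) is horizontal along the wall.
[cite: EntingJensen2009, §7.4.2, Fig. 7.10] -/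
theorem step_into_wall_horizontal (hp : ω ∈ pwb n) {t : ℕ} (ht1 : 1 ≤ t) (htn : t ≤ n) (ht2 : t % 2 = 0)
    (hY : ω t 1 = 0) : (ω (t - 1) 0 = ω t 0 + 1 ∨ ω (t - 1) 0 = ω t 0 - 1) ∧ ω (t - 1) 1 = 0 := by
  obtain ⟨hw, -⟩ := mem_pwb.1 hp
  obtain ⟨ha, -⟩ := mem_wbr.1 hw
  obtain ⟨hh, -, -⟩ := mem_archs.1 ha
  obtain ⟨hs, hhp⟩ := mem_hpw.1 hh
  obtain ⟨-, -, hbw, -⟩ := mem_saws_iff.1 hs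
  have hpar := parity_apply hs htn
  rw [hY, add_zero] at hpar
  have hY0 : ω (t - 1) 1 ≤ 0 := hhp (t - 1) (by omega)
  have hadj0 := (brickWallGraph_adj_coord _ _).1 (hbw (t - 1) (by omega))
  rw [show t - 1 + 1 = t by omega] at hadj0
  rcases hadj0 with ⟨h01, h11⟩ | ⟨h00, ⟨h1a, h1b⟩ | ⟨h1a, -⟩⟩
  · exact ⟨by omega, by rw [← h11, hY]⟩
  · exfalso; rw [hY] at h1a; rw [← h00] at h1b; omega
  · exfalso; rw [hY] at h1a; omega

/-- Lemma G: some even abscissa `m ∈ [2, X_n − 2]` is never the abscissa of a visit (if `ω 2 ≠ (2,0)` then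
`m = 2`; otherwise `m = a + 1` for the initial wall run `(0,0), …, (a,0)` followed by the down step at the odd
column `a`). [cite: MadrasSlade1993, §4.2, Definition 4.2.1] -/
theorem exists_gap (hω : ω ∈ ipwb n) (hn : 4 ≤ n) :
    ∃ m : ℤ, 2 ≤ m ∧ m + 2 ≤ ω n 0 ∧ m % 2 = 0 ∧ ∀ t ∈ wallTimes n ω, ω t 0 ≠ m := by
  classical
  obtain ⟨hp, hn1, hirr⟩ := mem_ipwb.1 hω
  obtain ⟨hw, hb⟩ := mem_pwb.1 hp
  obtain ⟨ha, -⟩ := mem_wbr.1 hw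
  obtain ⟨hh, hn2, hYn⟩ := mem_archs.1 ha
  obtain ⟨hs, hhp⟩ := mem_hpw.1 hh
  obtain ⟨h0, hend, hbw, hinj⟩ := mem_saws_iff.1 hs
  have hX0 : ω 0 0 = 0 := by rw [h0]; rfl
  have hY0 : ω 0 1 = 0 := by rw [h0]; rfl
  have hmemW : ∀ {t}, t ∈ wallTimes n ω ↔ (1 ≤ t ∧ t ≤ n) ∧ t % 2 = 0 ∧ ω t 1 = 0 := fun {t} => by
    rw [wallTimes, Finset.mem_filter, Finset.mem_Icc]
  have hinj' : ∀ {i j}, i ≤ n → j ≤ n → ω i 0 = ω j 0 → ω i 1 = ω j 1 → i = j := fun {i j} hi hj h0' h1' =>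
    hinj (show i ∈ {k | k ≤ n} from hi) (show j ∈ {k | k ≤ n} from hj) (site_ext_six h0' h1')
  -- the first step is `(0,0) → (1,0)`
  have h1X : ω 1 0 = 1 ∧ ω 1 1 = 0 := by
    have hadj' : brickWallGraph.Adj (ω 0) (ω 1) := hbw 0 (by omega)
    have hadj := (brickWallGraph_adj_coord _ _).1 hadj'
    have hpos := (hb 1 le_rfl (by omega)).1
    have hle := hhp 1 (by omega)
    rw [hX0] at hpos
    rw [hX0, hY0] at hadj
    rcases hadj with ⟨h01, h11⟩ | ⟨h00, ⟨h1a, -⟩ | ⟨h1a, h1b⟩⟩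
    · exact ⟨by omega, by rw [h11]⟩
    · exfalso; omega
    · exfalso; rw [← h00] at h1b; omega
  -- `X_n ≥ 4` and even
  have hLpar : ω n 0 % 2 = 0 := by
    have := parity_apply hs le_rfl; rw [hYn, add_zero] at this; omega
  obtain ⟨hXn1, hYn1⟩ := step_into_wall_horizontal hp hn1 le_rfl hn2 hYn
  have hXn1' : ω (n - 1) 0 = ω n 0 - 1 := by
    have := (hb (n - 1) (by omega) (by omega)).2; omega
  have hL4 : 4 ≤ ω n 0 := by
    have hpos := (hb n hn1 le_rfl).1
    rw [hX0] at hpos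
    by_contra hlt
    have hL2 : ω n 0 = 2 := by omega
    have := hinj' (i := n - 1) (j := 1) (by omega) (by omega) (by rw [hXn1', h1X.1, hL2]; norm_num)
      (by rw [hYn1, h1X.2])
    omega
  by_cases h2 : ω 2 0 = 2 ∧ ω 2 1 = 0
  · -- the initial wall run `(0,0), (1,0), …, (a,0)` and its end
    obtain ⟨d, hd⟩ : ∃ d, d ∈ stepsD n ω := Finset.card_pos.1 (one_le_card_stepsD hω hn)
    rw [stepsD, Finset.mem_filter, Finset.mem_range] at hd
    have hexQ : ∃ i, i ≤ n ∧ ¬ (ω i 0 = i ∧ ω i 1 = 0) := by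
      by_cases hdy : ω d 1 = 0
      · exact ⟨d + 1, by omega, fun h => by rw [h.2, hdy] at hd; norm_num at hd⟩
      · exact ⟨d, by omega, fun h => hdy h.2⟩
    obtain ⟨hbn, hbQ⟩ := Nat.find_spec hexQ
    have hQ : ∀ j, j < Nat.find hexQ → ω j 0 = j ∧ ω j 1 = 0 := fun j hj => by
      have := Nat.find_min hexQ hj
      push Not at this
      exact this (by omega)
    set b := Nat.find hexQ with hbdef
    have hb3 : 3 ≤ b := by
      by_contra hlt
      have h012 : b = 0 ∨ b = 1 ∨ b = 2 := by omega
      rcases h012 with h | h | h <;> rw [h] at hbQ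
      · exact hbQ ⟨by rw [hX0]; norm_num, hY0⟩
      · exact hbQ ⟨by rw [h1X.1]; norm_num, h1X.2⟩
      · exact hbQ ⟨by rw [h2.1]; norm_num, h2.2⟩
    -- the step `b-1 → b` is the down step at the odd column `a = b - 1`
    obtain ⟨hQa0, hQa1⟩ := hQ (b - 1) (by omega)
    obtain ⟨hQp0, hQp1⟩ := hQ (b - 2) (by omega)
    have hadj := (brickWallGraph_adj_coord _ _).1 (hbw (b - 1) (by omega))
    rw [show b - 1 + 1 = b by omega] at hadj
    have hbY : ω b 0 = ω (b - 1) 0 ∧ ω b 1 = -1 ∧ (ω (b - 1) 0) % 2 = 1 := by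
      rcases hadj with ⟨h01 | h01, h11⟩ | ⟨h00, ⟨h1a, -⟩ | ⟨h1a, h1b⟩⟩
      · exfalso; exact hbQ ⟨by rw [h01, hQa0]; omega, by rw [h11, hQa1]⟩
      · exfalso
        have := hinj' (i := b) (j := b - 2) hbn (by omega) (by rw [hQp0]; omega)
          (by rw [h11, hQa1, hQp1])
        omega
      · exfalso; have := hhp b hbn; rw [hQa1] at h1a; omega
      · rw [hQa1] at h1a; rw [h00] at h1b
        exact ⟨h00, by omega, by omega⟩
    obtain ⟨hbX, hbY1, hodd⟩ := hbY
    refine ⟨ω (b - 1) 0 + 1, by rw [hQa0]; omega, ?_, by omega, ?_⟩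
    · -- `m + 2 ≤ X_n`: `m ≤ X_n` by parity and `X_{b-1} ≤ X_n`, and `m ≠ X_n` since `(X_n, 0)` is visited
      have hle := (hb (b - 1) (by omega) (by omega)).2
      suffices hne : ω n 0 ≠ ω (b - 1) 0 + 1 by omega
      intro he
      -- `ω (n-1) = (a, 0) = ω a` or `X_{n-1} = X_n + 1`
      have := hinj' (i := n - 1) (j := b - 1) (by omega) (by omega) (by rw [hXn1', he]; ring) (by rw [hYn1, hQa1])
      -- then `n = b`, but `Y_b = -1 ≠ 0`
      have hnb : n = b := by omega
      rw [hnb] at hYn; rw [hYn] at hbY1; norm_num at hbY1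
    · intro t ht he
      obtain ⟨⟨ht1, htn⟩, ht2, hy⟩ := hmemW.1 ht
      obtain ⟨hx | hx, hy'⟩ := step_into_wall_horizontal hp ht1 htn ht2 hy
      · -- from the right: `X_{t-1} = a + 2`; then `t < n` and `ω (t+1) = (a, 0) = ω a`
        have htn' : t < n := by
          rcases lt_or_eq_of_le htn with h | h
          · exact h
          · exfalso; subst h; have := (hb (t - 1) (by omega) (by omega)).2; omega
        obtain ⟨⟨hx1 | hx1, hy1⟩, -, hne⟩ := wall_steps_horizontal hp ht1 htn' ht2 hy
        · exact hne (by rw [hx, hx1])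
        · have := hinj' (i := t + 1) (j := b - 1) (by omega) (by omega) (by rw [hx1, he]; ring) (by rw [hy1, hQa1])
          have ht' : t = b - 2 := by omega
          rw [ht', hQp0] at he; rw [hQa0] at he; omega
      · -- from the left: `ω (t-1) = (a, 0) = ω a`, so `t = b`, but `Y_b ≠ 0`
        have := hinj' (i := t - 1) (j := b - 1) (by omega) (by omega) (by rw [hx, he]; ring) (by rw [hy', hQa1])
        have ht' : t = b := by omega
        rw [ht'] at hy; rw [hy] at hbY1; norm_num at hbY1
  · -- `(2, 0)` is never visited
    refine ⟨2, le_rfl, by omega, by decide, fun t ht he => ?_⟩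
    obtain ⟨⟨ht1, htn⟩, ht2, hy⟩ := hmemW.1 ht
    have htn' : t < n := by
      rcases lt_or_eq_of_le htn with h | h
      · exact h
      · exfalso; subst h; omega
    obtain ⟨⟨hx1, hy1⟩, ⟨hx0, hy0⟩, hne⟩ := wall_steps_horizontal hp ht1 htn' ht2 hy
    rcases hx0 with hx0 | hx0
    · -- `X_{t-1} = 3`, so `X_{t+1} = 1`: `ω (t+1) = ω 1`, `t = 0`
      have hx1' : ω (t + 1) 0 = 1 := by omega
      have := hinj' (i := t + 1) (j := 1) (by omega) (by omega) (by rw [hx1', h1X.1]) (by rw [hy1, h1X.2])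
      omega
    · -- `ω (t-1) = (1, 0) = ω 1`, so `t = 2`: contradiction with the case
      have := hinj' (i := t - 1) (j := 1) (by omega) (by omega) (by rw [hx0, he, h1X.1]; norm_num)
        (by rw [hy0, h1X.2])
      have ht' : t = 2 := by omega
      subst ht'
      exact h2 ⟨he, hy⟩

/-- **The six-step law**: `6 · visits ≤ n` for every irreducible positive wall bridge of length `n ≥ 4`.
Assembly of Lemmas L, D, G with the step bookkeeping `n = X_n + 2·#left + 2·#down`.
[cite: MadrasSlade1993, §4.2, remark before (4.2.21) (p. 94: an irreducible bridge of span L has at least 3L steps)] -/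
theorem six_mul_visits_le (hω : ω ∈ ipwb n) (hn : 4 ≤ n) : 6 * visits n ω ≤ n := by
  classical
  obtain ⟨hp, hn1, hirr⟩ := mem_ipwb.1 hω
  obtain ⟨hw, hb⟩ := mem_pwb.1 hp
  obtain ⟨ha, -⟩ := mem_wbr.1 hw
  obtain ⟨hh, hn2, hYn⟩ := mem_archs.1 ha
  obtain ⟨hs, hhp⟩ := mem_hpw.1 hh
  obtain ⟨h0, hend, hbw, hinj⟩ := mem_saws_iff.1 hs
  have hX0 : ω 0 0 = 0 := by rw [h0]; rfl
  have hY0 : ω 0 1 = 0 := by rw [h0]; rfl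
  obtain ⟨hcnt, hX, hY⟩ := steps_count hbw
  rw [hX0, sub_zero] at hX
  rw [hY0, hYn, sub_zero] at hY
  obtain ⟨m, hm2, hmL, hme, hmW⟩ := exists_gap hω hn
  have hD1 := one_le_card_stepsD hω hn
  set R := stepsR n ω
  set L := stepsL n ω
  set U := stepsU n ω
  set D := stepsD n ω
  set W := wallTimes n ω with hWdef
  have hmemW : ∀ {t}, t ∈ W ↔ (1 ≤ t ∧ t ≤ n) ∧ t % 2 = 0 ∧ ω t 1 = 0 := fun {t} => by
    rw [hWdef, wallTimes, Finset.mem_filter, Finset.mem_Icc]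
  have hWinj : ∀ {t t'}, t ∈ W → t' ∈ W → ω t 0 = ω t' 0 → t = t' := fun {t t'} ht ht' he => by
    obtain ⟨⟨-, htn⟩, -, hy⟩ := hmemW.1 ht
    obtain ⟨⟨-, htn'⟩, -, hy'⟩ := hmemW.1 ht'
    exact hinj (show t ∈ {i | i ≤ n} from htn) (show t' ∈ {i | i ≤ n} from htn') (site_ext_six he (by rw [hy, hy']))
  have hWeven : ∀ {t}, t ∈ W → ω t 0 % 2 = 0 ∧ 0 < ω t 0 ∧ ω t 0 ≤ ω n 0 := fun {t} ht => by
    obtain ⟨⟨ht1, htn⟩, ht2, hy⟩ := hmemW.1 ht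
    have hpar := parity_apply hs htn
    rw [hy, add_zero] at hpar
    have hbt := hb t ht1 htn
    rw [hX0] at hbt
    exact ⟨by omega, hbt.1, hbt.2⟩
  -- (1) abscissa count with the gap `m`: `2 · #W + 2 ≤ X_n`
  have hA : 2 * (#W : ℤ) + 2 ≤ ω n 0 := by
    have hmem : m / 2 ∈ Finset.Icc (1 : ℤ) (ω n 0 / 2) := by rw [Finset.mem_Icc]; constructor <;> omega
    have h1 : #W ≤ #((Finset.Icc (1 : ℤ) (ω n 0 / 2)).erase (m / 2)) := by
      refine Finset.card_le_card_of_injOn (fun t => ω t 0 / 2) (fun t ht => ?_) (fun t ht t' ht' he => ?_)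
      · have ht0 := Finset.mem_coe.1 ht
        obtain ⟨he, hpos, hle⟩ := hWeven ht0
        rw [Finset.mem_coe, Finset.mem_erase, Finset.mem_Icc]
        show ω t 0 / 2 ≠ m / 2 ∧ 1 ≤ ω t 0 / 2 ∧ ω t 0 / 2 ≤ ω n 0 / 2
        exact ⟨fun h => hmW t ht0 (by omega), by omega, by omega⟩
      · obtain ⟨he1, -, -⟩ := hWeven (Finset.mem_coe.1 ht)
        obtain ⟨he2, -, -⟩ := hWeven (Finset.mem_coe.1 ht')
        exact hWinj (Finset.mem_coe.1 ht) (Finset.mem_coe.1 ht') (by dsimp only at he; omega)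
    rw [Finset.card_erase_of_mem hmem, Int.card_Icc] at h1
    have h3 := Int.toNat_of_nonneg (show (0 : ℤ) ≤ ω n 0 / 2 + 1 - 1 by omega)
    omega
  -- interior visit times
  have hnW : n ∈ W := hmemW.2 ⟨⟨hn1, le_rfl⟩, hn2, hYn⟩
  set W' := W.erase n with hW'def
  have hWW' : #W = #W' + 1 := (Finset.card_erase_add_one hnW).symm
  have hmemW' : ∀ {t}, t ∈ W' → 1 ≤ t ∧ t < n ∧ t % 2 = 0 ∧ ω t 1 = 0 ∧ t ∈ W := fun {t} ht => by
    obtain ⟨hne, htW⟩ := Finset.mem_erase.1 ht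
    obtain ⟨⟨ht1, htn⟩, ht2, hy⟩ := hmemW.1 htW
    exact ⟨ht1, lt_of_le_of_ne htn hne, ht2, hy, htW⟩
  set E := W'.filter fun t => NearRenewal n ω t with hEdef
  have hEW' : E ⊆ W' := Finset.filter_subset _ _
  have hsd : #(W' \ E) + #E = #W' := Finset.card_sdiff_add_card_eq_card hEW'
  set Lod := L.filter fun i => ¬ ω (i + 1) 0 % 2 = 0 with hLod
  set Lev := L.filter fun i => ω (i + 1) 0 % 2 = 0 with hLev
  have hLsplit : #Lev + #Lod = #L := Finset.card_filter_add_card_filter_not _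
  have hmemL : ∀ {i}, i ∈ L ↔ i < n ∧ ω (i + 1) 0 = ω i 0 - 1 := fun {i} => by
    show i ∈ stepsL n ω ↔ _; rw [stepsL, Finset.mem_filter, Finset.mem_range]
  -- (2a) every interior visit owns a left step landing on its own (even) column
  have hBev : #W' ≤ #Lev := by
    have hex : ∀ t ∈ W', ∃ i, i < n ∧ ω (i + 1) 0 = ω i 0 - 1 ∧ ω (i + 1) 0 = ω t 0 := fun t ht => by
      obtain ⟨ht1, htn, ht2, hy, -⟩ := hmemW' ht
      obtain ⟨⟨h1 | h1, -⟩, ⟨h0', -⟩, hne⟩ := wall_steps_horizontal hp ht1 htn ht2 hy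
      · exact exists_left_step_onto hω ht1 htn ht2 hy h1
      · refine ⟨t - 1, by omega, ?_, ?_⟩
        · rw [show t - 1 + 1 = t by omega]; omega
        · rw [show t - 1 + 1 = t by omega]
    let φ : ℕ → ℕ := fun t => if h : t ∈ W' then Classical.choose (hex t h) else 0
    have hφ : ∀ t (h : t ∈ W'), φ t < n ∧ ω (φ t + 1) 0 = ω (φ t) 0 - 1 ∧ ω (φ t + 1) 0 = ω t 0 := fun t h => by
      simp only [φ, dif_pos h]; exact Classical.choose_spec (hex t h)
    refine Finset.card_le_card_of_injOn φ (fun t ht => ?_) (fun t ht t' ht' he => ?_)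
    · have ht' := Finset.mem_coe.1 ht
      obtain ⟨h1, h2, h3⟩ := hφ t ht'
      have htW := (hmemW' ht').2.2.2.2
      rw [Finset.mem_coe, hLev, Finset.mem_filter, hmemL]
      exact ⟨⟨h1, h2⟩, by rw [h3]; exact (hWeven htW).1⟩
    · have h1 := Finset.mem_coe.1 ht
      have h2 := Finset.mem_coe.1 ht'
      obtain ⟨-, -, e1⟩ := hφ t h1
      obtain ⟨-, -, e2⟩ := hφ t' h2
      exact hWinj (hmemW' h1).2.2.2.2 (hmemW' h2).2.2.2.2 (by rw [← e1, ← e2, he])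
  -- (2b) every interior visit that is not a near-renewal owns a left step landing on the odd column `X_t − 1`
  have hBod : #(W' \ E) ≤ #Lod := by
    have hex : ∀ t ∈ W' \ E, ∃ i, i < n ∧ ω (i + 1) 0 = ω i 0 - 1 ∧ ω (i + 1) 0 = ω t 0 - 1 := fun t ht => by
      rw [Finset.mem_sdiff] at ht
      obtain ⟨ht', htE⟩ := ht
      obtain ⟨ht1, htn, ht2, hy, -⟩ := hmemW' ht'
      rcases exists_left_step_onto_pred hω ht1 htn ht2 hy with h | h
      · exact h
      · exact absurd (show t ∈ E by rw [hEdef, Finset.mem_filter]; exact ⟨ht', h⟩) htE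
    let ψ : ℕ → ℕ := fun t => if h : t ∈ W' \ E then Classical.choose (hex t h) else 0
    have hψ : ∀ t (h : t ∈ W' \ E), ψ t < n ∧ ω (ψ t + 1) 0 = ω (ψ t) 0 - 1 ∧ ω (ψ t + 1) 0 = ω t 0 - 1 :=
      fun t h => by simp only [ψ, dif_pos h]; exact Classical.choose_spec (hex t h)
    have hW'of : ∀ {t}, t ∈ W' \ E → t ∈ W := fun {t} ht => (hmemW' (Finset.mem_sdiff.1 ht).1).2.2.2.2
    refine Finset.card_le_card_of_injOn ψ (fun t ht => ?_) (fun t ht t' ht' he => ?_)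
    · have ht' := Finset.mem_coe.1 ht
      obtain ⟨h1, h2, h3⟩ := hψ t ht'
      have hev := (hWeven (hW'of ht')).1
      rw [Finset.mem_coe, hLod, Finset.mem_filter, hmemL]
      exact ⟨⟨h1, h2⟩, by rw [h3]; omega⟩
    · have h1 := Finset.mem_coe.1 ht
      have h2 := Finset.mem_coe.1 ht'
      obtain ⟨-, -, e1⟩ := hψ t h1
      obtain ⟨-, -, e2⟩ := hψ t' h2
      exact hWinj (hW'of h1) (hW'of h2) (by
        have : ω t 0 - 1 = ω t' 0 - 1 := by rw [← e1, ← e2, he]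
        omega)
  -- (3) down steps owned by the near-renewals
  have hDE : 2 * #E ≤ #D := two_mul_card_nearRenewal_le_card_stepsD hω (T := E) fun t ht => by
    rw [hEdef, Finset.mem_filter] at ht
    obtain ⟨ht', hnr⟩ := ht
    obtain ⟨-, htn, -, -, htW⟩ := hmemW' ht'
    exact ⟨htW, htn, hnr⟩
  -- conclusion
  rw [visits_eq_card]
  show 6 * #W ≤ n
  have hcnt' : ((#R + #L + #U + #D : ℕ) : ℤ) = n := by exact_mod_cast hcnt
  push_cast at hcnt'
  omega

/-- **Corollary**: an irreducible positive wall bridge of length `2s ≥ 4` has at most `s/3` visits — the class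
`(s, v)` of the irreducible census is empty whenever `3v > s`. NEW.
[cite: BeatonBousquetMelouDeGierDuminilCopinGuttmann2014, §3.1 (arXiv v5 p. 8: surface visits of half-plane walks)] -/
theorem three_mul_visits_le {s : ℕ} (hω : ω ∈ ipwb (2 * s)) (hs : 2 ≤ s) : 3 * visits (2 * s) ω ≤ s := by
  have := six_mul_visits_le hω (by omega)
  omega

/-! ### §5 The envelope of the irreducible weights: `Λ_{2s}(y) ≤ μ^{2s+2} · y^{⌊s/3⌋}`, `f_s(y) ≤ μ^{2s+2} / y^{s − ⌊s/3⌋}` -/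

/-- Per walk: `y^{visits} ≤ y^{⌊s/3⌋}` on `ipwb (2s)`, `s ≥ 2`, `y ≥ 1` (the six-step law).
[cite: MadrasSlade1993, §4.2, remark before (4.2.21) (p. 94)] -/
theorem pow_visits_le_pow_div_three {y : ℝ} (hy : 1 ≤ y) {s : ℕ} (hs : 2 ≤ s) (hω : ω ∈ ipwb (2 * s)) :
    y ^ visits (2 * s) ω ≤ y ^ (s / 3) :=
  pow_le_pow_right₀ hy (by have := three_mul_visits_le hω hs; omega)

/-- **Envelope of the irreducible generating function** (`y ≥ 1`, `s ≥ 2`): `Λ_{2s}(y) = IPWB (2s) y ≤ μ^{2s+2} · y^{⌊s/3⌋}`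
— the six-step law for the weight, `#ipwb_{2s} ≤ #wbr_{2s} ≤ μ^{2s+2}` for the count. Improves the tree's
`IPWB_le_pow_mul_sqrt_pow` (`… · (√y)^{s+1}`). NEW. [cite: MadrasSlade1993, §4.2, remark before (4.2.21) (p. 94); §1.2, (1.2.16)–(1.2.17) (p. 11)] -/
theorem IPWB_le_pow_mul_pow_div_three {y : ℝ} (hy : 1 ≤ y) {s : ℕ} (hs : 2 ≤ s) :
    IPWB (2 * s) y ≤ hexConnectiveConstant ^ (2 * s + 2) * y ^ (s / 3) := by
  have hy0 : 0 ≤ y := by linarith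
  have hμ := hexConnectiveConstant_pos
  have hterm : ∀ ω ∈ ipwb (2 * s), y ^ visits (2 * s) ω ≤ y ^ (s / 3) := fun ω hω =>
    pow_visits_le_pow_div_three hy hs hω
  have hcard : (#(ipwb (2 * s)) : ℝ) ≤ #(wbr (2 * s)) := by
    exact_mod_cast Finset.card_le_card (ipwb_subset.trans pwb_subset)
  calc IPWB (2 * s) y ≤ ∑ ω ∈ ipwb (2 * s), y ^ (s / 3) := Finset.sum_le_sum hterm
    _ = #(ipwb (2 * s)) * y ^ (s / 3) := by rw [Finset.sum_const, nsmul_eq_mul]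
    _ ≤ #(wbr (2 * s)) * y ^ (s / 3) := mul_le_mul_of_nonneg_right hcard (pow_nonneg hy0 _)
    _ ≤ _ := mul_le_mul_of_nonneg_right (card_wbr_le_pow (2 * s)) (pow_nonneg hy0 _)

/-- `y ≤ β(y)²` via `y ≤ P₂(y) ≤ β(y)²` (private twin of the tree's private `le_sq_wallRate_wren`).
[cite: HammersleyTorrieWhittington1982, §2 (β(y) ≥ √y: walks sticking to the surface)] -/
private theorem le_sq_wallRate_six {y : ℝ} (hy : 0 < y) : y ≤ wallRate y ^ 2 :=
  le_trans (by rw [pow_one]) ((pow_le_PWB hy.le 1).trans (PWB_le_pow hy 1))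

/-- **Envelope of the renewal law** (`y ≥ 1`, `s ≥ 2`): `f_s(y) = Λ_{2s}(y)/β(y)^{2s} ≤ μ^{2s+2} · y^{⌊s/3⌋} / y^s` — on the
diagonal `s − v = k` of Kesten's identity each term is `O(y^{−2s/3})`, so every order of the `1/y` expansion of `β(y)²` is a
finite census plus a geometric tail of ratio `μ² · y^{−2/3}`. NEW. [cite: MadrasSlade1993, §4.2, (4.2.4) and Theorem 4.2.2 (pp. 91–92)]
[cite: Kesten1963SAW, Section 4] -/
theorem pwbLaw_le_pow_mul_pow_div_three_div {y : ℝ} (hy : 1 ≤ y) {s : ℕ} (hs : 2 ≤ s) :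
    pwbLaw y s ≤ hexConnectiveConstant ^ (2 * s + 2) * y ^ (s / 3) / y ^ s := by
  have hy0 : 0 < y := by linarith
  have hμ := hexConnectiveConstant_pos
  have hβ : y ^ s ≤ wallRate y ^ (2 * s) := by
    rw [pow_mul]; exact pow_le_pow_left₀ hy0.le (le_sq_wallRate_six hy0) s
  unfold pwbLaw
  calc IPWB (2 * s) y / wallRate y ^ (2 * s)
        ≤ hexConnectiveConstant ^ (2 * s + 2) * y ^ (s / 3) / wallRate y ^ (2 * s) :=
        div_le_div_of_nonneg_right (IPWB_le_pow_mul_pow_div_three hy hs) (pow_nonneg (wallRate_pos y).le _)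
    _ ≤ _ := div_le_div_of_nonneg_left (mul_nonneg (pow_nonneg hμ.le _) (pow_nonneg hy0.le _)) (pow_pos hy0 _) hβ

/-- The same envelope with the powers of `y` merged: `f_s(y) ≤ μ^{2s+2} / y^{s − ⌊s/3⌋}` (`y ≥ 1`, `s ≥ 2`). NEW.
[cite: MadrasSlade1993, §4.2, (4.2.4) and Theorem 4.2.2 (pp. 91–92)] -/
theorem pwbLaw_le_pow_div_pow_sub {y : ℝ} (hy : 1 ≤ y) {s : ℕ} (hs : 2 ≤ s) :
    pwbLaw y s ≤ hexConnectiveConstant ^ (2 * s + 2) / y ^ (s - s / 3) := by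
  have hy0 : 0 < y := by linarith
  have h := pwbLaw_le_pow_mul_pow_div_three_div hy hs
  have hsplit : y ^ s = y ^ (s - s / 3) * y ^ (s / 3) := by
    rw [← pow_add]; congr 1; omega
  rwa [hsplit, mul_div_mul_right _ _ (pow_ne_zero _ hy0.ne')] at h


end Literature.Probability.RandomPlanarGeometry.SAW.HexBW.Wall
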